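import Summits.NavierStokesRegularity.OSWSelfSimilar.SheetRSpectrumOddAssemblyReal
import Summits.NavierStokesRegularity.OSWSelfSimilar.SheetRTimeShiftModeWeakEigen
import Summits.NavierStokesRegularity.OSWSelfSimilar.SheetRCentreReencoding
import HarnessLib

/-!
# SHEET-ℝ, Z3-SR-SPEC: THE ODD-CLASS SPECTRAL WORD AS ONE KERNEL THEOREM at the certified zero `Ω*` —
# selfsim's real assembly ∘ cert-5's (P6) transport and (P8) + re-encoding, with the interval sentences as the only named hypotheses

HONEST FRAMING (cell ns-blowup GROUP B / zone Z3, case Z3-SR-SPEC (PREREG-SHEET-R-SPEC, PASS word RULING (dx)(4)/(gg)(1)); 1-D MODEL certificate frame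
(viscous gCLM/OSW sheet on the line); computer-assisted; not Euler/NS; «violates: none — MODEL»). This file is COMPOSITION ONLY — the «OWED-optional for a
successor» line of selfsim g12's DONE (STATUS l.8619: «the literal end-to-end instantiation … once a cert seat holds v₀ as a kernel object»; here `v₀` stays an
abstract real odd `L²_w` class `h_R = f_R`, so nothing of the frame's dyadics is pinned). NOTHING here is interval arithmetic and NOTHING asserts the hypotheses hold.
THE OPERATOR. Centre datum `hcs : IsCentre L Ω* Ω*₁ H₀*` (the certified zero in the primitive form of record), the encoding
`K* := −PopC hL λ a hcs + F′`, `d* := drift a Ω*`, `V* := potential L λ Ω*` of `A*_F = DG(Ω*) + F′`, with the rank-one lift of record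
`F′ q := (θ·⟪h_R, ιE q⟫_w)·f_R` (PREREG P1: `θ = 4`, `h_R = f_R = v₀` through the Riesz identity `⟨h, w·⟩ = (v₀, ·)_E`), so that selfsim's
`A − θ⟪h_R + 0i, ·⟫(f_R + 0i) = DG(Ω*)` on the odd class.
* `rankOneLift_apply` — `F′ q = (θ·⟪h_R, ιE q⟫)·f_R` for `F′ := (θ • (⟪h_R, ·⟫ ∘ ιE)).smulRight f_R` (no definition: a Mathlib `smulRight`).
* **`weakEigen_set_eq_singleton_of_weakZero`** (general `L, a, λ`): from (i) a Gårding datum `hstar` for `(d*, V*, K*)` with `−m* < −3/100` [(S1) + (P8)],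
  (ii) implementation 2's `RectLabelCertificate` for THE Evans function `evansOdd hL K* hstar ⟪h_R+0i, ·⟫ (f_R+0i) θ` and the far-field chain + ONE literal
  inequality [(S2)], (iii) the WEAK ZERO OF RECORD: `Ω* = ∫₀Ω*₁` odd with finite weights (all inside `hcs`) solving the profile equation against every `C_c^∞`
  test at `ν = 1`, and `Ω*(X₀) ≠ 0` [existence row]: the set of `σ` with `Re σ > −3/100` carrying a non-trivial weak eigenvector of `A* − θℓ(·)f` is `{1}`,
  AND (`weakEigen_one_simple_of_weakZero`) `σ = 1` is simple (eigenvectors = the multiples of `R_{K*}(1)(f_R + 0i) ≠ 0`, no weak Jordan chain) — the (P6)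
  hypothesis of selfsim's assembly being DISCHARGED inside by cert-5's `timeShiftMode_isWeakImage` (time-shift mode `Ω* + ½ξΩ*′`).
* **`gardingDataKC_star_of_centre`** (frame `(L, a) = (8, 1/5)`, any `λ`): the datum `hstar` of (i) FROM THE (S1) DATUM AT THE CENTRE `Ω̄`
  (`GardingDataKC 8 _ (drift (1/5) Ω̄) (potential 8 λ Ω̄) (−PopC̄ + F′) D₀ D₁ V₀ c m`, the interval sentence of record with `c = c₂ = 1/5`, `m = c₁ + γ = 3/20`)
  and the existence row `‖u‖_E ≤ r`, `L_lip·r < c`, `Ω* = Ω̄ + prim (der u)`: constants `(c − L_lip r, m − L_lip r/4)` — cert-5's (P8)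
  `gardingDataKC_perturbedCentre` followed by `SheetRCentreReencoding.gardingDataKC_reencode`;
* **`weakEigen_set_eq_singleton_of_centre`** / `weakEigen_one_simple_of_centre` — the two composed at `(8, 1/5, λ)`; and §5
  **`weakEigen_set_eq_singleton_of_record`** / `weakEigen_one_simple_of_record` at the literals `λ = θ = 4`, `h_R = f_R`, `(c, m) = (1/5, 3/20)`,
  `r = rE♯₂` with the two side conditions closed by `norm_num` (`Llip_mul_rEsharp2_lt`, `neg_mstar_lt_ra`): the PASS word
  «σ_p(−DG(Ω*)|odd) ∩ {Re σ > −3/100} = {1}, algebraically simple» as a kernel theorem MODULO EXACTLY: the (S1) Gårding sentence at the centre (two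
  arithmetics of record), impl-2's `RectLabelCertificate` + far-field literal for the `Ω*`-encoded Evans function, the existence row's radius, and the weak zero
  of record with `Ω*(X₀) ≠ 0` (the NK certificate's `|Ω*(X₀)| > 0`), plus `3/20 − L_lip r/4 > 3/100`.
* §6 (APPEND) `weakEigen_set_eq_singleton_of_weakZero'` / `weakEigen_set_eq_singleton_of_record'` — the same with the far field as ONE hypothesis `hfar`
  (the output shape `RectLabelCertificate E ∧ hfar E` of cert-2 g8's `SheetRSpectrumPointCertificate`).
No definition, no named fact, no number of record moves. WHAT THIS IS NOT: not NS; not a proof that any hypothesis holds; (P9)/(P10) untouched (SPECTRAL word).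
-/

noncomputable section

namespace Summit.NavierStokesRegularity.OSWSelfSimilar
namespace SheetRSpectrumEndToEnd

open _root_.MeasureTheory _root_.Set _root_.Filter _root_.Real Literature.Analysis.Fourier SheetRWeakProfilePV SheetRWeakToStrong
  SheetREnergyClass SheetRWeightedMeasure SheetREnergySpace SheetRLinearisedTests SheetRTestSpace SheetRLinearisedFormBounds
  SheetRSolutionOperator SheetRComplexPivot SheetRAssemblyOperators SheetRCertificateAssembly SheetRGeneratorOddWeak SheetROddClass
  SheetRResolventOddClass SheetREvansOdd SheetRSpectrumWindingLists SheetRSpectrumOddAssembly SheetRSpectrumOddAssemblyReal SheetRWeakEigenReal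
  SheetRPerturbedResolventC SheetRLinearisationPerturbation SheetRTimeShiftModeWeak SheetRTimeShiftModeWeakEigen SheetRCentreReencoding
  Literature.Analysis.OperatorTheory Complex
open scoped Topology ENNReal InnerProductSpace ContDiff

/-! ### §1 The rank-one lift of record as a bounded real operator -/

/-- The rank-one lift `F′ := (θ • (⟪h_R, ·⟫ ∘ ιE)).smulRight f_R` acts as `F′ q = (θ·⟪h_R, ιE q⟫)·f_R`. [folklore] -/
theorem rankOneLift_apply {L : ℝ} (hL : 0 < L) (hR fR : W L) (θ : ℝ) (q : Esp L hL) :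
    ((θ • ((innerSL ℝ hR).comp (ιE hL))).smulRight fR) q = (θ * ⟪hR, ιE hL q⟫_ℝ) • fR := by
  rw [ContinuousLinearMap.smulRight_apply, _root_.smul_apply, ContinuousLinearMap.comp_apply, innerSL_apply_apply, smul_eq_mul]

/-! ### §2 The word at `Ω*` from a datum for the `Ω*` encoding, the (S2) certificate, and the weak zero of record -/

section AtStar

variable {L : ℝ} (hL : 0 < L) (lam a : ℝ) {Ωs Ωs₁ : ℝ → ℝ} {Hs : ℝ} (hcs : IsCentre L Ωs Ωs₁ Hs)
  (hR fR : W L) (hf : fR ∈ Wodd L) (θ : ℝ) {D₀ D₁ V₀ c m : ℝ}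
  (hstar : GardingDataKC L hL (drift a Ωs) (potential L lam Ωs)
    (-PopC hL lam a hcs + (θ • ((innerSL ℝ hR).comp (ιE hL))).smulRight fR) D₀ D₁ V₀ c m)
  (hm : -m < ra)
  (hcert : RectLabelCertificate (evansOdd hL _ hstar ((innerSL ℂ (ofRealW L hR)).comp (Wcodd L).subtypeL) (realOdd fR hf) θ))
  {z : ℂ} (hz : -m < z.re) {ac : ℕ → Wc L} (ha0 : ac 0 = ofRealW L fR)
  (hchain : ∀ j < 3, ac j = resolventKC hL _ hstar z (ac (j + 1) + z • ac j))
  (hB : ‖(θ : ℂ)‖ * (‖⟪ofRealW L hR, ac 0⟫_ℂ‖ / ((1141 : ℝ) / 100) + ‖⟪ofRealW L hR, ac 1⟫_ℂ‖ / ((1141 : ℝ) / 100) ^ 2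
    + (‖⟪ofRealW L hR, ac 2⟫_ℂ‖ + ‖ofRealW L hR‖ * ‖ac 3‖ / (m + ra)) / ((1141 : ℝ) / 100) ^ 3) < 1)
  (hweak : ∀ ψ : ℝ → ℝ, ContDiff ℝ ∞ ψ → HasCompactSupport ψ →
    (∫ x, (Ωs x + 1 / 2 * x * Ωs₁ x + a * (∫ s in (0 : ℝ)..x, hilbertTransform Ωs s) * Ωs₁ x
      - hilbertTransform Ωs x * Ωs x) * ψ x) + ∫ x, Ωs₁ x * deriv ψ x = 0)
  {X₀ : ℝ} (hX₀ : Ωs X₀ ≠ 0)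

include hweak hX₀ in
/-- **The gauge mode of record in the assembly's dischargeable form.** From the weak zero `Ω*` (data of `hcs`, the profile equation at `ν = 1`,
`Ω*(X₀) ≠ 0`): an energy-space `p ≠ 0` with `prim (der p) = Ω* + ½ξΩ*′` satisfying the REAL weak equation `(A* )p = F′p − p` against every compactly
supported test, for the encoding `(d*, V*, K* = −PopC* + F′)`. [folklore] -/
theorem exists_real_gaugeMode :
    ∃ p : Esp L hL, p ≠ 0 ∧ prim (der p) = (fun ξ => Ωs ξ + 1 / 2 * ξ * deriv Ωs ξ) ∧
      ∀ v v₁ : ℝ → ℝ, IsCompactTest v v₁ →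
        linForm L (drift a Ωs) (potential L lam Ωs) (prim (der p)) (der p) v v₁
            + (∫ y, (L ^ 2 + y ^ 2) *
                ((((-PopC hL lam a hcs + (θ • ((innerSL ℝ hR).comp (ιE hL))).smulRight fR) p : W L) : ℝ → ℝ) y * v y)) =
          ∫ y, (L ^ 2 + y ^ 2) * ((((θ * ⟪hR, ιE hL p⟫_ℝ) • fR - ιE hL p : W L) : ℝ → ℝ) y * v y) := by
  -- regularity and the strong equation of the time-shift mode (cert-5 g5), from the weak zero of record
  have hweak' : ∀ ψ : ℝ → ℝ, ContDiff ℝ ∞ ψ → HasCompactSupport ψ →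
      (∫ x, (Ωs x + 1 / 2 * x * Ωs₁ x + a * (∫ s in (0 : ℝ)..x, hilbertTransform Ωs s) * Ωs₁ x
        - hilbertTransform Ωs x * Ωs x) * ψ x) + 1 * ∫ x, Ωs₁ x * deriv ψ x = 0 := fun ψ hψ hψc => by
    rw [one_mul]; exact hweak ψ hψ hψc
  obtain ⟨⟨hΩ3, -⟩, hveq, hvodd, hvw0, hvw1⟩ :=
    SheetRTimeShiftModeAssembly.timeShiftMode_eigen_and_energy_of_weakZero (a := a) hL one_pos hcs.primitive hcs.odd hcs.measurable
      hcs.weight₀ hcs.weight₁ hweak' rfl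
  have hstrong : ∀ X, (Ωs X + 1 / 2 * X * deriv Ωs X) + 1 / 2 * X * deriv (fun ξ => Ωs ξ + 1 / 2 * ξ * deriv Ωs ξ) X
      + a * ((∫ s in (0 : ℝ)..X, hilbertTransform (fun ξ => Ωs ξ + 1 / 2 * ξ * deriv Ωs ξ) s) * deriv Ωs X
        + (∫ s in (0 : ℝ)..X, hilbertTransform Ωs s) * deriv (fun ξ => Ωs ξ + 1 / 2 * ξ * deriv Ωs ξ) X)
      - hilbertTransform (fun ξ => Ωs ξ + 1 / 2 * ξ * deriv Ωs ξ) X * Ωs X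
      - hilbertTransform Ωs X * (Ωs X + 1 / 2 * X * deriv Ωs X)
      - iteratedDeriv 2 (fun ξ => Ωs ξ + 1 / 2 * ξ * deriv Ωs ξ) X = -(Ωs X + 1 / 2 * X * deriv Ωs X) := fun X => by
    have h := hveq X
    rw [one_mul] at h
    exact h
  obtain ⟨P, hPv, -, hW⟩ := timeShiftMode_isWeakImage hL lam a hcs hΩ3 rfl hvodd hvw0 hvw1 hstrong
  have hP0 : P ≠ 0 := esp_ne_zero_of_timeShiftMode hL (hΩ3.of_le (by norm_num)) rfl hX₀ hPv
  refine ⟨P, hP0, hPv, fun v v₁ hv => ?_⟩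
  set F' : Esp L hL →L[ℝ] W L := (θ • ((innerSL ℝ hR).comp (ιE hL))).smulRight fR with hF'
  obtain ⟨h1, -⟩ := hW F' v v₁ hv
  have hfst : (WithLp.toLp 2 (P, (0 : Esp L hL))).fst = P := rfl
  have hre : reW L (ofPair L (WithLp.toLp 2 (F' P - ιE hL P, (0 : W L)))) = F' P - ιE hL P := by
    rw [← (toPair_fst_snd _).1, toPair_ofPair]; rfl
  have hF'P : F' P = (θ * ⟪hR, ιE hL P⟫_ℝ) • fR := by rw [hF']; exact rankOneLift_apply hL hR fR θ P
  rw [hfst, hre, hF'P] at h1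
  exact h1

include hm hcert hz ha0 hchain hB hweak hX₀ in
/-- **Z3-SR-SPEC ODD CLASS, EXISTENCE/UNIQUENESS HALF, AT `Ω*`.** Modulo the `Ω*`-encoded Gårding datum `hstar` (with `−m < −3/100`), implementation 2's
label certificate and far-field chain + literal for THE Evans function of `(d*, V*, K*)`, and the weak zero of record with `Ω*(X₀) ≠ 0`:
`{σ : Re σ > −3/100 ∧ ∃ u ≠ 0 weak eigenvector of A* − θ⟪h_R+0i, ·⟫(f_R+0i) at σ} = {1}`. MODEL statement; not NS. [folklore] -/
theorem weakEigen_set_eq_singleton_of_weakZero :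
    {σ : ℂ | ra < σ.re ∧ ∃ u : Wcodd L, u ≠ 0 ∧
      IsWeakEigen hL (-PopC hL lam a hcs + (θ • ((innerSL ℝ hR).comp (ιE hL))).smulRight fR) (drift a Ωs) (potential L lam Ωs)
        ((innerSL ℂ (ofRealW L hR)).comp (Wcodd L).subtypeL) (realOdd fR hf) (θ : ℂ) σ u} = {1} := by
  obtain ⟨p, hp, -, hwp⟩ := exists_real_gaugeMode hL lam a hcs hR fR θ hweak hX₀
  exact weakEigen_set_eq_singleton_real hL _ hstar hm hR fR hf θ hcert hz ha0 hchain hB hp hwp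

include hm hcert hweak hX₀ in
/-- **Z3-SR-SPEC ODD CLASS, SIMPLICITY HALF, AT `Ω*`.** Same hypotheses minus the far field: `R_{K*}(1)(f_R + 0i) ≠ 0`, the weak eigenvectors at `σ = 1`
are exactly its multiples, and no weak Jordan chain exists over a non-zero eigenvector. MODEL statement; not NS. [folklore] -/
theorem weakEigen_one_simple_of_weakZero :
    resolventOdd hL _ hstar 1 (realOdd fR hf) ≠ 0 ∧
      (∀ u : Wcodd L,
        IsWeakEigen hL (-PopC hL lam a hcs + (θ • ((innerSL ℝ hR).comp (ιE hL))).smulRight fR) (drift a Ωs) (potential L lam Ωs)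
            ((innerSL ℂ (ofRealW L hR)).comp (Wcodd L).subtypeL) (realOdd fR hf) (θ : ℂ) 1 u ↔
          ∃ t : ℂ, u = t • resolventOdd hL _ hstar 1 (realOdd fR hf)) ∧
      ∀ δ₀ : Wcodd L, δ₀ ≠ 0 →
        IsWeakEigen hL (-PopC hL lam a hcs + (θ • ((innerSL ℝ hR).comp (ιE hL))).smulRight fR) (drift a Ωs) (potential L lam Ωs)
            ((innerSL ℂ (ofRealW L hR)).comp (Wcodd L).subtypeL) (realOdd fR hf) (θ : ℂ) 1 δ₀ →
          ¬ ∃ δ₁ : Wcodd L,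
            IsWeakJordan hL (-PopC hL lam a hcs + (θ • ((innerSL ℝ hR).comp (ιE hL))).smulRight fR) (drift a Ωs) (potential L lam Ωs)
              ((innerSL ℂ (ofRealW L hR)).comp (Wcodd L).subtypeL) (realOdd fR hf) (θ : ℂ) 1 δ₀ δ₁ := by
  obtain ⟨p, hp, -, hwp⟩ := exists_real_gaugeMode hL lam a hcs hR fR θ hweak hX₀
  exact weakEigen_one_simple_real hL _ hstar hm hR fR hf θ hcert hp hwp

end AtStar

/-! ### §3 The datum at `Ω*` from the (S1) datum at the centre: (P8) + re-encoding, frame `(L, a) = (8, 1/5)` -/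

section FromCentre

variable {h8 : (0 : ℝ) < 8} (lam : ℝ) {Ω Ω₁ Ωs Ωs₁ : ℝ → ℝ} {H₀ Hs : ℝ} (hc : IsCentre 8 Ω Ω₁ H₀) (hcs : IsCentre 8 Ωs Ωs₁ Hs)
  (u : Esp 8 h8) (hsum : ∀ y, Ωs y = Ω y + prim (der u) y)
  (hR fR : W 8) (θ : ℝ) {D₀ D₁ V₀ c m r : ℝ}
  (hbar : GardingDataKC 8 h8 (drift (1 / 5) Ω) (potential 8 lam Ω)
    (-PopC h8 lam (1 / 5) hc + (θ • ((innerSL ℝ hR).comp (ιE h8))).smulRight fR) D₀ D₁ V₀ c m)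
  (hu : ‖u‖ ≤ r) (hcr : (CertificateViscousSheetR.Llip : ℝ) * r < c)

include hsum hbar hu hcr in
/-- **THE (S1) DATUM MOVED TO `Ω*` AND RE-ENCODED.** From the Gårding datum `(c, m)` of the CENTRE encoding `(drift (1/5) Ω̄, potential 8 λ Ω̄, −PopC̄ + F′)`
and the existence row (`‖u‖_E ≤ r`, `L_lip·r < c`, `Ω* = Ω̄ + prim (der u)`): the datum `(c − L_lip r, m − L_lip r/4)` for the `Ω*` encoding
`(drift (1/5) Ω*, potential 8 λ Ω*, −PopC* + F′)` (coefficient fields from `coef_bounds` at `Ω*`). MODEL statement; not NS. [folklore] -/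
theorem gardingDataKC_star_of_centre :
    GardingDataKC 8 h8 (drift (1 / 5) Ωs) (potential 8 lam Ωs)
      (-PopC h8 lam (1 / 5) hcs + (θ • ((innerSL ℝ hR).comp (ιE h8))).smulRight fR)
      (|(1 / 5 : ℝ)| * (Real.sqrt (π / (4 * 8)) * Real.sqrt (∫ y, ((8 : ℝ) ^ 2 + y ^ 2) * Ωs y ^ 2))) (1 / 2) (1 + Hs + |lam|)
      (c - CertificateViscousSheetR.Llip * r) (m - CertificateViscousSheetR.Llip * r / 4) :=
  gardingDataKC_reencode h8 lam (1 / 5) hc hcs u hsum _ (gardingDataKC_perturbedCentre hbar u hu hcr)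

end FromCentre

/-! ### §4 The word at `Ω*` from the centre datum: everything composed, frame `(8, 1/5)` -/

section Composed

variable {h8 : (0 : ℝ) < 8} (lam : ℝ) {Ω Ω₁ Ωs Ωs₁ : ℝ → ℝ} {H₀ Hs : ℝ} (hc : IsCentre 8 Ω Ω₁ H₀) (hcs : IsCentre 8 Ωs Ωs₁ Hs)
  (u : Esp 8 h8) (hsum : ∀ y, Ωs y = Ω y + prim (der u) y)
  (hR fR : W 8) (hf : fR ∈ Wodd 8) (θ : ℝ) {D₀ D₁ V₀ c m r : ℝ}
  (hbar : GardingDataKC 8 h8 (drift (1 / 5) Ω) (potential 8 lam Ω)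
    (-PopC h8 lam (1 / 5) hc + (θ • ((innerSL ℝ hR).comp (ιE h8))).smulRight fR) D₀ D₁ V₀ c m)
  (hu : ‖u‖ ≤ r) (hcr : (CertificateViscousSheetR.Llip : ℝ) * r < c)
  (hm : -(m - CertificateViscousSheetR.Llip * r / 4) < ra)
  (hcert : RectLabelCertificate (evansOdd h8 _ (gardingDataKC_star_of_centre lam hc hcs u hsum hR fR θ hbar hu hcr)
    ((innerSL ℂ (ofRealW 8 hR)).comp (Wcodd 8).subtypeL) (realOdd fR hf) θ))
  {z : ℂ} (hz : -(m - CertificateViscousSheetR.Llip * r / 4) < z.re) {ac : ℕ → Wc 8} (ha0 : ac 0 = ofRealW 8 fR)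
  (hchain : ∀ j < 3, ac j = resolventKC h8 _ (gardingDataKC_star_of_centre lam hc hcs u hsum hR fR θ hbar hu hcr) z (ac (j + 1) + z • ac j))
  (hB : ‖(θ : ℂ)‖ * (‖⟪ofRealW 8 hR, ac 0⟫_ℂ‖ / ((1141 : ℝ) / 100) + ‖⟪ofRealW 8 hR, ac 1⟫_ℂ‖ / ((1141 : ℝ) / 100) ^ 2
    + (‖⟪ofRealW 8 hR, ac 2⟫_ℂ‖ + ‖ofRealW 8 hR‖ * ‖ac 3‖ / ((m - CertificateViscousSheetR.Llip * r / 4) + ra)) / ((1141 : ℝ) / 100) ^ 3) < 1)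
  (hweak : ∀ ψ : ℝ → ℝ, ContDiff ℝ ∞ ψ → HasCompactSupport ψ →
    (∫ x, (Ωs x + 1 / 2 * x * Ωs₁ x + 1 / 5 * (∫ s in (0 : ℝ)..x, hilbertTransform Ωs s) * Ωs₁ x
      - hilbertTransform Ωs x * Ωs x) * ψ x) + ∫ x, Ωs₁ x * deriv ψ x = 0)
  {X₀ : ℝ} (hX₀ : Ωs X₀ ≠ 0)

include hm hcert hz ha0 hchain hB hweak hX₀ in
/-- **THE Z3-SR-SPEC ODD-CLASS WORD AT THE CERTIFIED ZERO, COMPOSED** (frame `L = 8`, `a = 1/5`, any `λ`, real `θ`, odd real `h_R = f_R`-type data):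
modulo (i) the (S1) Gårding sentence at the centre `Ω̄`, (ii) the existence row (`‖u‖_E ≤ r`, `L_lip r < c`, `Ω* = Ω̄ + prim (der u)`) with
`m − L_lip r/4 > 3/100`, (iii) implementation 2's `RectLabelCertificate` and far-field chain + literal for the `Ω*`-encoded Evans function, (iv) the weak
zero of record with `Ω*(X₀) ≠ 0`: `{σ : Re σ > −3/100 ∧ A* − θ⟪h_R+0i,·⟫(f_R+0i) has a non-trivial weak eigenvector at σ} = {1}` — in the cell's
dictionary «σ_p(−DG(Ω*)|odd) ∩ {Re σ > −3/100} = {1}». MODEL statement; not NS. [folklore] -/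
theorem weakEigen_set_eq_singleton_of_centre :
    {σ : ℂ | ra < σ.re ∧ ∃ w : Wcodd 8, w ≠ 0 ∧
      IsWeakEigen h8 (-PopC h8 lam (1 / 5) hcs + (θ • ((innerSL ℝ hR).comp (ιE h8))).smulRight fR) (drift (1 / 5) Ωs)
        (potential 8 lam Ωs) ((innerSL ℂ (ofRealW 8 hR)).comp (Wcodd 8).subtypeL) (realOdd fR hf) (θ : ℂ) σ w} = {1} :=
  weakEigen_set_eq_singleton_of_weakZero h8 lam (1 / 5) hcs hR fR hf θ (gardingDataKC_star_of_centre lam hc hcs u hsum hR fR θ hbar hu hcr)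
    hm hcert hz ha0 hchain hB hweak hX₀

include hm hcert hweak hX₀ in
/-- **… and the simplicity of `σ = 1`, composed.** MODEL statement; not NS. [folklore] -/
theorem weakEigen_one_simple_of_centre :
    resolventOdd h8 _ (gardingDataKC_star_of_centre lam hc hcs u hsum hR fR θ hbar hu hcr) 1 (realOdd fR hf) ≠ 0 ∧
      (∀ w : Wcodd 8,
        IsWeakEigen h8 (-PopC h8 lam (1 / 5) hcs + (θ • ((innerSL ℝ hR).comp (ιE h8))).smulRight fR) (drift (1 / 5) Ωs)
            (potential 8 lam Ωs) ((innerSL ℂ (ofRealW 8 hR)).comp (Wcodd 8).subtypeL) (realOdd fR hf) (θ : ℂ) 1 w ↔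
          ∃ t : ℂ, w = t • resolventOdd h8 _ (gardingDataKC_star_of_centre lam hc hcs u hsum hR fR θ hbar hu hcr) 1 (realOdd fR hf)) ∧
      ∀ δ₀ : Wcodd 8, δ₀ ≠ 0 →
        IsWeakEigen h8 (-PopC h8 lam (1 / 5) hcs + (θ • ((innerSL ℝ hR).comp (ιE h8))).smulRight fR) (drift (1 / 5) Ωs)
            (potential 8 lam Ωs) ((innerSL ℂ (ofRealW 8 hR)).comp (Wcodd 8).subtypeL) (realOdd fR hf) (θ : ℂ) 1 δ₀ →
          ¬ ∃ δ₁ : Wcodd 8,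
            IsWeakJordan h8 (-PopC h8 lam (1 / 5) hcs + (θ • ((innerSL ℝ hR).comp (ιE h8))).smulRight fR) (drift (1 / 5) Ωs)
              (potential 8 lam Ωs) ((innerSL ℂ (ofRealW 8 hR)).comp (Wcodd 8).subtypeL) (realOdd fR hf) (θ : ℂ) 1 δ₀ δ₁ :=
  weakEigen_one_simple_of_weakZero h8 lam (1 / 5) hcs hR fR hf θ (gardingDataKC_star_of_centre lam hc hcs u hsum hR fR θ hbar hu hcr)
    hm hcert hweak hX₀

end Composed

/-! ### §5 The literals of record: `λ = 4`, `θ = 4`, `c = c₂ = 1/5`, `m = c₁ + γ = 3/20`, `r = rE♯₂` -/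

/-- `L_lip·rE♯₂ < 1/5` (`95777/50000 · 6.80e-6 ≈ 1.30e-5`). [folklore] -/
theorem Llip_mul_rEsharp2_lt : (CertificateViscousSheetR.Llip : ℝ) * CertificateViscousSheetR.rEsharp2 < 1 / 5 := by
  norm_num [CertificateViscousSheetR.Llip, CertificateViscousSheetR.rEsharp2]

/-- `−(3/20 − L_lip·rE♯₂/4) < −3/100`: the `Ω*`-datum's half-plane contains the closed rectangle. [folklore] -/
theorem neg_mstar_lt_ra : -((3 : ℝ) / 20 - CertificateViscousSheetR.Llip * CertificateViscousSheetR.rEsharp2 / 4) < ra := by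
  norm_num [CertificateViscousSheetR.Llip, CertificateViscousSheetR.rEsharp2, ra]

section Record

variable {h8 : (0 : ℝ) < 8} {Ω Ω₁ Ωs Ωs₁ : ℝ → ℝ} {H₀ Hs : ℝ} (hc : IsCentre 8 Ω Ω₁ H₀) (hcs : IsCentre 8 Ωs Ωs₁ Hs)
  (u : Esp 8 h8) (hsum : ∀ y, Ωs y = Ω y + prim (der u) y)
  (hR : W 8) (hh : hR ∈ Wodd 8) {D₀ D₁ V₀ : ℝ}
  (hS1 : GardingDataKC 8 h8 (drift (1 / 5) Ω) (potential 8 4 Ω)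
    (-PopC h8 4 (1 / 5) hc + ((4 : ℝ) • ((innerSL ℝ hR).comp (ιE h8))).smulRight hR) D₀ D₁ V₀ (1 / 5) (3 / 20))
  (hu : ‖u‖ ≤ (CertificateViscousSheetR.rEsharp2 : ℝ))
  (hcert : RectLabelCertificate (evansOdd h8 _
    (gardingDataKC_star_of_centre 4 hc hcs u hsum hR hR 4 hS1 hu Llip_mul_rEsharp2_lt)
    ((innerSL ℂ (ofRealW 8 hR)).comp (Wcodd 8).subtypeL) (realOdd hR hh) 4))
  {z : ℂ} (hz : -((3 : ℝ) / 20 - CertificateViscousSheetR.Llip * CertificateViscousSheetR.rEsharp2 / 4) < z.re) {ac : ℕ → Wc 8}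
  (ha0 : ac 0 = ofRealW 8 hR)
  (hchain : ∀ j < 3, ac j = resolventKC h8 _
    (gardingDataKC_star_of_centre 4 hc hcs u hsum hR hR 4 hS1 hu Llip_mul_rEsharp2_lt) z (ac (j + 1) + z • ac j))
  (hB : ‖((4 : ℝ) : ℂ)‖ * (‖⟪ofRealW 8 hR, ac 0⟫_ℂ‖ / ((1141 : ℝ) / 100) + ‖⟪ofRealW 8 hR, ac 1⟫_ℂ‖ / ((1141 : ℝ) / 100) ^ 2
    + (‖⟪ofRealW 8 hR, ac 2⟫_ℂ‖ + ‖ofRealW 8 hR‖ * ‖ac 3‖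
        / (((3 : ℝ) / 20 - CertificateViscousSheetR.Llip * CertificateViscousSheetR.rEsharp2 / 4) + ra)) / ((1141 : ℝ) / 100) ^ 3) < 1)
  (hweak : ∀ ψ : ℝ → ℝ, ContDiff ℝ ∞ ψ → HasCompactSupport ψ →
    (∫ x, (Ωs x + 1 / 2 * x * Ωs₁ x + 1 / 5 * (∫ s in (0 : ℝ)..x, hilbertTransform Ωs s) * Ωs₁ x
      - hilbertTransform Ωs x * Ωs x) * ψ x) + ∫ x, Ωs₁ x * deriv ψ x = 0)
  {X₀ : ℝ} (hX₀ : Ωs X₀ ≠ 0)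

include hcert hz ha0 hchain hB hweak hX₀ in
/-- **THE WORD OF RECORD, composed at the literals** (`a = 1/5`, `λ = 4`, `θ = 4`, `h_R = f_R = v₀` an odd real `L²_w` class, `(c₂, c₁ + γ) = (1/5, 3/20)`,
`r = rE♯₂`; the side conditions `L_lip·rE♯₂ < 1/5` and `3/20 − L_lip·rE♯₂/4 > 3/100` are closed by `norm_num`): modulo the (S1) sentence at the centre, impl-2's
certificate + far-field literal for the `Ω*`-encoded Evans function, ‖u‖_E ≤ rE♯₂ with `Ω* = Ω̄ + prim (der u)`, and the weak zero of record with
`Ω*(X₀) ≠ 0` — «{σ : Re σ > −3/100 ∧ −DG(Ω*)|odd has a non-trivial weak eigenvector at σ} = {1}». MODEL statement; not NS. [folklore] -/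
theorem weakEigen_set_eq_singleton_of_record :
    {σ : ℂ | ra < σ.re ∧ ∃ w : Wcodd 8, w ≠ 0 ∧
      IsWeakEigen h8 (-PopC h8 4 (1 / 5) hcs + ((4 : ℝ) • ((innerSL ℝ hR).comp (ιE h8))).smulRight hR) (drift (1 / 5) Ωs)
        (potential 8 4 Ωs) ((innerSL ℂ (ofRealW 8 hR)).comp (Wcodd 8).subtypeL) (realOdd hR hh) ((4 : ℝ) : ℂ) σ w} = {1} :=
  weakEigen_set_eq_singleton_of_centre 4 hc hcs u hsum hR hR hh 4 hS1 hu Llip_mul_rEsharp2_lt neg_mstar_lt_ra hcert hz ha0 hchain hB hweak hX₀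

include hcert hweak hX₀ in
/-- **… and `σ = 1` is simple, at the literals of record.** MODEL statement; not NS. [folklore] -/
theorem weakEigen_one_simple_of_record :
    resolventOdd h8 _ (gardingDataKC_star_of_centre 4 hc hcs u hsum hR hR 4 hS1 hu Llip_mul_rEsharp2_lt) 1 (realOdd hR hh) ≠ 0 ∧
      (∀ w : Wcodd 8,
        IsWeakEigen h8 (-PopC h8 4 (1 / 5) hcs + ((4 : ℝ) • ((innerSL ℝ hR).comp (ιE h8))).smulRight hR) (drift (1 / 5) Ωs)
            (potential 8 4 Ωs) ((innerSL ℂ (ofRealW 8 hR)).comp (Wcodd 8).subtypeL) (realOdd hR hh) ((4 : ℝ) : ℂ) 1 w ↔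
          ∃ t : ℂ, w = t • resolventOdd h8 _ (gardingDataKC_star_of_centre 4 hc hcs u hsum hR hR 4 hS1 hu Llip_mul_rEsharp2_lt) 1 (realOdd hR hh)) ∧
      ∀ δ₀ : Wcodd 8, δ₀ ≠ 0 →
        IsWeakEigen h8 (-PopC h8 4 (1 / 5) hcs + ((4 : ℝ) • ((innerSL ℝ hR).comp (ιE h8))).smulRight hR) (drift (1 / 5) Ωs)
            (potential 8 4 Ωs) ((innerSL ℂ (ofRealW 8 hR)).comp (Wcodd 8).subtypeL) (realOdd hR hh) ((4 : ℝ) : ℂ) 1 δ₀ →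
          ¬ ∃ δ₁ : Wcodd 8,
            IsWeakJordan h8 (-PopC h8 4 (1 / 5) hcs + ((4 : ℝ) • ((innerSL ℝ hR).comp (ιE h8))).smulRight hR) (drift (1 / 5) Ωs)
              (potential 8 4 Ωs) ((innerSL ℂ (ofRealW 8 hR)).comp (Wcodd 8).subtypeL) (realOdd hR hh) ((4 : ℝ) : ℂ) 1 δ₀ δ₁ :=
  weakEigen_one_simple_of_centre 4 hc hcs u hsum hR hR hh 4 hS1 hu Llip_mul_rEsharp2_lt neg_mstar_lt_ra hcert hweak hX₀

end Record

/-! ### §6 (APPEND) The same with the far field as ONE hypothesis `hfar` — the output shape of cert-2 g8's point-certificate file -/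

section AtStarFar

variable {L : ℝ} (hL : 0 < L) (lam a : ℝ) {Ωs Ωs₁ : ℝ → ℝ} {Hs : ℝ} (hcs : IsCentre L Ωs Ωs₁ Hs)
  (hR fR : W L) (hf : fR ∈ Wodd L) (θ : ℝ) {D₀ D₁ V₀ c m : ℝ}
  (hstar : GardingDataKC L hL (drift a Ωs) (potential L lam Ωs)
    (-PopC hL lam a hcs + (θ • ((innerSL ℝ hR).comp (ιE hL))).smulRight fR) D₀ D₁ V₀ c m)
  (hm : -m < ra)
  (hcert : RectLabelCertificate (evansOdd hL _ hstar ((innerSL ℂ (ofRealW L hR)).comp (Wcodd L).subtypeL) (realOdd fR hf) θ))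
  (hfar : ∀ σ : ℂ, ra < σ.re → (1141 : ℝ) / 100 < ‖σ‖ →
    evansOdd hL _ hstar ((innerSL ℂ (ofRealW L hR)).comp (Wcodd L).subtypeL) (realOdd fR hf) θ σ ≠ 0)
  (hweak : ∀ ψ : ℝ → ℝ, ContDiff ℝ ∞ ψ → HasCompactSupport ψ →
    (∫ x, (Ωs x + 1 / 2 * x * Ωs₁ x + a * (∫ s in (0 : ℝ)..x, hilbertTransform Ωs s) * Ωs₁ x
      - hilbertTransform Ωs x * Ωs x) * ψ x) + ∫ x, Ωs₁ x * deriv ψ x = 0)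
  {X₀ : ℝ} (hX₀ : Ωs X₀ ≠ 0)

include hm hcert hfar hweak hX₀ in
/-- **Z3-SR-SPEC odd class at `Ω*`, far field as ONE named hypothesis** (`RectLabelCertificate E ∧ hfar E` is exactly the conclusion of cert-2 g8's
`SheetRSpectrumPointCertificate`; by `SheetRCentreReencoding.evansOdd_reencode` it may be certified in either encoding): `{σ : Re σ > −3/100 ∧ ∃ u ≠ 0 weak
eigenvector} = {1}`, the (P6) hypothesis discharged inside from the weak zero of record. MODEL statement; not NS. [folklore] -/
theorem weakEigen_set_eq_singleton_of_weakZero' :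
    {σ : ℂ | ra < σ.re ∧ ∃ u : Wcodd L, u ≠ 0 ∧
      IsWeakEigen hL (-PopC hL lam a hcs + (θ • ((innerSL ℝ hR).comp (ιE hL))).smulRight fR) (drift a Ωs) (potential L lam Ωs)
        ((innerSL ℂ (ofRealW L hR)).comp (Wcodd L).subtypeL) (realOdd fR hf) (θ : ℂ) σ u} = {1} := by
  obtain ⟨p, hp, -, hwp⟩ := exists_real_gaugeMode hL lam a hcs hR fR θ hweak hX₀
  exact weakEigen_set_eq_singleton hL _ hstar hm _ _ _ hcert hfar (cplx_ne_zero hL hp) (weakEigen_one_real hL _ hstar hR fR hf θ hwp)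

end AtStarFar

section RecordFar

variable {h8 : (0 : ℝ) < 8} {Ω Ω₁ Ωs Ωs₁ : ℝ → ℝ} {H₀ Hs : ℝ} (hc : IsCentre 8 Ω Ω₁ H₀) (hcs : IsCentre 8 Ωs Ωs₁ Hs)
  (u : Esp 8 h8) (hsum : ∀ y, Ωs y = Ω y + prim (der u) y)
  (hR : W 8) (hh : hR ∈ Wodd 8) {D₀ D₁ V₀ : ℝ}
  (hS1 : GardingDataKC 8 h8 (drift (1 / 5) Ω) (potential 8 4 Ω)
    (-PopC h8 4 (1 / 5) hc + ((4 : ℝ) • ((innerSL ℝ hR).comp (ιE h8))).smulRight hR) D₀ D₁ V₀ (1 / 5) (3 / 20))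
  (hu : ‖u‖ ≤ (CertificateViscousSheetR.rEsharp2 : ℝ))
  (hcert : RectLabelCertificate (evansOdd h8 _
    (gardingDataKC_star_of_centre 4 hc hcs u hsum hR hR 4 hS1 hu Llip_mul_rEsharp2_lt)
    ((innerSL ℂ (ofRealW 8 hR)).comp (Wcodd 8).subtypeL) (realOdd hR hh) 4))
  (hfar : ∀ σ : ℂ, ra < σ.re → (1141 : ℝ) / 100 < ‖σ‖ →
    evansOdd h8 _ (gardingDataKC_star_of_centre 4 hc hcs u hsum hR hR 4 hS1 hu Llip_mul_rEsharp2_lt)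
      ((innerSL ℂ (ofRealW 8 hR)).comp (Wcodd 8).subtypeL) (realOdd hR hh) 4 σ ≠ 0)
  (hweak : ∀ ψ : ℝ → ℝ, ContDiff ℝ ∞ ψ → HasCompactSupport ψ →
    (∫ x, (Ωs x + 1 / 2 * x * Ωs₁ x + 1 / 5 * (∫ s in (0 : ℝ)..x, hilbertTransform Ωs s) * Ωs₁ x
      - hilbertTransform Ωs x * Ωs x) * ψ x) + ∫ x, Ωs₁ x * deriv ψ x = 0)
  {X₀ : ℝ} (hX₀ : Ωs X₀ ≠ 0)

include hcert hfar hweak hX₀ in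
/-- **THE WORD OF RECORD with the (S2) hypothesis in cert-2 g8's output shape** (`RectLabelCertificate E ∧ hfar E`): modulo the (S1) sentence at the centre,
‖u‖_E ≤ rE♯₂ with `Ω* = Ω̄ + prim (der u)`, the (S2) pair for the `Ω*`-encoded Evans function (equivalently, by `evansOdd_reencode`, for the centre-encoded
one), and the weak zero of record with `Ω*(X₀) ≠ 0` — «σ_p(−DG(Ω*)|odd) ∩ {Re σ > −3/100} = {1}». MODEL statement; not NS. [folklore] -/
theorem weakEigen_set_eq_singleton_of_record' :
    {σ : ℂ | ra < σ.re ∧ ∃ w : Wcodd 8, w ≠ 0 ∧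
      IsWeakEigen h8 (-PopC h8 4 (1 / 5) hcs + ((4 : ℝ) • ((innerSL ℝ hR).comp (ιE h8))).smulRight hR) (drift (1 / 5) Ωs)
        (potential 8 4 Ωs) ((innerSL ℂ (ofRealW 8 hR)).comp (Wcodd 8).subtypeL) (realOdd hR hh) ((4 : ℝ) : ℂ) σ w} = {1} :=
  weakEigen_set_eq_singleton_of_weakZero' h8 4 (1 / 5) hcs hR hR hh 4
    (gardingDataKC_star_of_centre 4 hc hcs u hsum hR hR 4 hS1 hu Llip_mul_rEsharp2_lt) neg_mstar_lt_ra hcert hfar hweak hX₀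

end RecordFar

end SheetRSpectrumEndToEnd
end Summit.NavierStokesRegularity.OSWSelfSimilar

end
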